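import Summits.AtomisticToContinuum.Crystallization.Theses.ThreeConeCertificate

/-!
# Route `ThreeConeCertificate` — glue `SlackToBulk` (stmt-AtomisticToContinuum-11965)

`SlackToBulk := SlackRigidity → BulkDefectVanish`: slack rigidity (all but `o(N)` particles of an
injective configuration sequence with energy excess `o(N)` are `ε`-matched in `B_R` to one rotated
copy of a fixed periodic configuration `P`) specialises to sequences of Lennard-Jones ground
states, because a ground state is by definition an injective configuration whose energy equals
`E(N)` (`IsGroundState V x := Function.Injective x ∧ interactionEnergy V x = groundStateEnergy V d N`,
Blanc–Lewin 2015, §1.2), so its excess quotient `(𝓔(x_N) − E(N))/N` is identically `0`.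
Pure bookkeeping over the tree's definitions; nothing from print is used. [folklore]
-/

namespace Summit.AtomisticToContinuum.Crystallization.Theorems

open Literature.MathematicalPhysics.StatisticalMechanics
open Filter Topology

/-- Settles `stmt-AtomisticToContinuum-11965` (`SlackToBulk` of route `ThreeConeCertificate`):
`SlackRigidity → BulkDefectVanish`. Take the periodic configuration `P` from `SlackRigidity`; for
a sequence of ground states `x N`, each `x N` is injective (`(hx N).1`) and has zero energy excess
(`(hx N).2`), so the excess-per-particle sequence is the constant `0` and converges to `0`
(`tendsto_const_nhds`); `SlackRigidity` then yields exactly the conclusion of `BulkDefectVanish`.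
[folklore] -/
theorem slackToBulk_proof :
    Summit.AtomisticToContinuum.Crystallization.Theses.ThreeConeCertificate.SlackToBulk := by
  unfold Theses.ThreeConeCertificate.SlackToBulk Theses.ThreeConeCertificate.SlackRigidity
    Theses.ThreeConeCertificate.BulkDefectVanish
  rintro ⟨P, hP⟩
  refine ⟨P, fun R ε hR hε x hx => hP R ε hR hε x (fun N => (hx N).1) ?_⟩
  have h0 : (fun N : ℕ => (interactionEnergy lennardJones (x N) -
      groundStateEnergy lennardJones 3 N) / N) = fun _ => 0 := by
    funext N
    rw [(hx N).2, sub_self, zero_div]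
  rw [h0]
  exact tendsto_const_nhds

end Summit.AtomisticToContinuum.Crystallization.Theorems
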